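import Literature.NumberTheory.PAdicHodge.FontaineOmega
import Literature.NumberTheory.PAdicHodge.BmaxPlusLog
import HarnessLib

/-!
# Elements of `𝔸_inf` killed by `θ ∘ φᵏ` for `k ≤ n` are divisible by `ξ·φ⁻¹(ξ)⋯φ⁻ⁿ(ξ)`

Topic `Literature/NumberTheory/PAdicHodge`; namespace `Literature.NumberTheory.PAdicHodge`. THEOREMS ONLY (no definition, no named
fact, no instance). For `𝔸_inf(F) = 𝕎(𝒪_{ℂ_F}♭)` with Fontaine's `ξ = [p♭] − p` (`ker θ = (ξ)`), the Witt-vector Frobenius `φ`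
(an automorphism, inverse `σ = (frobeniusEquiv p _).symm`) and `u = [ε] − 1`:

* `frobenius_iterate_xi`, `fontaineTheta_frobenius_iterate_xi` — `φⁱ(ξ) = [p♭]^{pⁱ} − p`, `θ(φⁱξ) = p^{pⁱ} − p`, which is
  **nonzero for `i ≥ 1`** (`fontaineTheta_frobenius_iterate_xi_ne_zero`: `‖p‖ < 1` in `ℂ_F`);
* `frobenius_iterate_symm_iterate_xi` — `φʲ(σʲξ) = ξ`; `dvd_of_fontaineTheta_frobenius_iterate_eq_zero` — **`ker(θ∘φʲ) = σʲ(ξ)·𝔸_inf`**;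
* ★ `exists_eq_prod_mul_of_forall_fontaineTheta_frobenius_iterate_eq_zero` — **if `θ(φᵏa) = 0` for all `k ≤ n` then
  `a = (∏_{j≤n} σʲξ)·b`** (induction: `θ(φⁿ⁺¹(σʲξ)) = θ(φ^{n+1−j}ξ) ≠ 0` for `j ≤ n`, and `𝒪_{ℂ_F}` is a domain);
* `fontaineTheta_frobenius_iterate_uAinf` — **`θ(φᵏ u) = 0` for every `k`** (`u = [ε] − 1`, `θ[ε^{pᵏ}] = 1`), and the telescoping
  `uAinf_eq_prod_mul_symm_iterate` — **`u = (∏_{j≤n} σʲω)·σⁿ⁺¹(u)`** with Fontaine's `ω = u/σ(u)` (`FontaineOmega.omega`).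

This is the algebraic half of Fontaine's lemma «`{a ∈ 𝔸_inf : θ(φᵏa) = 0 ∀k ≥ 0} = ([ε]−1)·𝔸_inf`» (Astérisque 223, Exp. II
Prop. 5.1.x / "`I^{[1]}𝔸_inf`"), the `𝔸_inf`-input of the `t`-divisibility statement (TDIV) of the φ-road of line `kato_lever`
(crux K★ `stmt-BirchSwinnertonDyer-22226`, memo `Cruxes/StarredOptimalManinUnitFiveSeven/Lines/kato-lever-K2-fontaine-lemma.md` §1).
The remaining (valuation) half: pass to the limit `n → ∞` using `v(ε^{1/pⁿ} − 1) → 0` in `𝒪_{ℂ_F}♭` and the `p`-adic completeness of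
`𝔸_inf`. Infrastructure only: BSD / K★ are not proved by any of this.

## References
* [FontaineAsterisque223III] J.-M. Fontaine, *Le corps des périodes p-adiques*, Astérisque 223 (1994), Exp. II §1.2, Exp. III §5.1–5.2.
* [FontaineOuyang2022] J.-M. Fontaine, Y. Ouyang, *Theory of p-adic Galois representations*, Prop. 4.4.3, §6.1.
-/

noncomputable section

open WittVector Field ValuativeRel Finset

namespace Literature.NumberTheory.PAdicHodge

open Literature.NumberTheory.GaloisRepresentations
open Literature.NumberTheory.GaloisRepresentations.IsNonarchimedeanLocalField

variable {F : Type} [Field F] [ValuativeRel F] [TopologicalSpace F] [IsNonarchimedeanLocalField F]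
  [CharZero F] {p : ℕ} [Fact p.Prime] [Fact (¬ IsUnit (p : integerC F))]
  [IsAdicComplete (Ideal.span {(p : integerC F)}) (integerC F)]

/-! ### `φⁱ(ξ) = [p♭]^{pⁱ} − p` and `θ(φⁱξ) = p^{pⁱ} − p ≠ 0` -/

omit [CharZero F] [IsAdicComplete (Ideal.span {(p : integerC F)}) (integerC F)] in
/-- **`φⁱ(ξ) = [p♭]^{pⁱ} − p`.** [cite: FontaineAsterisque223III, Exp. II §1.2] -/
theorem frobenius_iterate_xi (i : ℕ) :
    (WittVector.frobenius : Ainf (p := p) F →+* Ainf (p := p) F)^[i] xi = teichmuller p pFlat ^ p ^ i - (p : Ainf (p := p) F) := by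
  induction i with
  | zero => rw [Function.iterate_zero, id, pow_zero, pow_one, xi_def]
  | succ i ih =>
    rw [Function.iterate_succ_apply', ih, map_sub, map_natCast, map_pow, frobenius_teichmuller, ← pow_mul, ← pow_succ']

omit [CharZero F] in
/-- **`θ(φⁱξ) = p^{pⁱ} − p`.** [cite: FontaineAsterisque223III, Exp. II §1.2] -/
theorem fontaineTheta_frobenius_iterate_xi (i : ℕ) :
    fontaineTheta (integerC F) p ((WittVector.frobenius : Ainf (p := p) F →+* Ainf (p := p) F)^[i] xi) =
      (p : integerC F) ^ p ^ i - p := by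
  rw [frobenius_iterate_xi, map_sub, map_pow, fontaineTheta_teichmuller, untilt_pFlat, map_natCast]

/-- **`θ(φⁱξ) ≠ 0` for `i ≥ 1`** (`p^{pⁱ} − p = p(p^{pⁱ−1} − 1)` and `‖p‖ < 1` in `ℂ_F`). [cite: FontaineAsterisque223III, Exp. III §5.1] -/
theorem fontaineTheta_frobenius_iterate_xi_ne_zero {i : ℕ} (hi : 1 ≤ i) :
    fontaineTheta (integerC F) p ((WittVector.frobenius : Ainf (p := p) F →+* Ainf (p := p) F)^[i] xi) ≠ 0 := by
  rw [fontaineTheta_frobenius_iterate_xi, sub_ne_zero]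
  intro h
  have h1 := congrArg (fun z : integerC F => ‖(z : CompletedAlgClosure F)‖) h
  simp only [SubmonoidClass.coe_pow, coe_natCast_integerC, norm_pow] at h1
  have hlt : ‖(p : CompletedAlgClosure F)‖ < 1 := norm_natCast_C_lt_one'
  have hpos : 0 < ‖(p : CompletedAlgClosure F)‖ := norm_pos_iff.2 (natCast_C_ne_zero (Fact.out : p.Prime).ne_zero)
  have h2 : 1 < p ^ i := Nat.one_lt_pow (by omega) (Fact.out : p.Prime).one_lt
  have h3 : ‖(p : CompletedAlgClosure F)‖ ^ p ^ i < ‖(p : CompletedAlgClosure F)‖ ^ 1 := pow_lt_pow_right_of_lt_one₀ hpos hlt h2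
  rw [pow_one, h1] at h3
  exact lt_irrefl _ h3

/-! ### `σ = φ⁻¹` and the generators `σʲ(ξ)` of `ker(θ ∘ φʲ)` -/

omit [CharZero F] [IsAdicComplete (Ideal.span {(p : integerC F)}) (integerC F)] in
/-- `φʲ(σʲ x) = x` for `σ = φ⁻¹`. [folklore] -/
private theorem frobenius_iterate_symm_iterate (j : ℕ) (x : Ainf (p := p) F) :
    (WittVector.frobenius : Ainf (p := p) F →+* Ainf (p := p) F)^[j]
      (((WittVector.frobeniusEquiv p (PreTilt (integerC F) p)).symm : Ainf (p := p) F → Ainf (p := p) F)^[j] x) = x := by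
  induction j generalizing x with
  | zero => rfl
  | succ j ih =>
    rw [Function.iterate_succ_apply', Function.iterate_succ_apply, ih, ← WittVector.frobeniusEquiv_apply, RingEquiv.apply_symm_apply]

omit [CharZero F] [IsAdicComplete (Ideal.span {(p : integerC F)}) (integerC F)] in
/-- `σʲ(φʲ x) = x` for `σ = φ⁻¹`. [folklore] -/
private theorem symm_iterate_frobenius_iterate (j : ℕ) (x : Ainf (p := p) F) :
    (((WittVector.frobeniusEquiv p (PreTilt (integerC F) p)).symm : Ainf (p := p) F → Ainf (p := p) F)^[j]
      ((WittVector.frobenius : Ainf (p := p) F →+* Ainf (p := p) F)^[j] x)) = x := by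
  induction j generalizing x with
  | zero => rfl
  | succ j ih =>
    rw [Function.iterate_succ_apply', Function.iterate_succ_apply, ih, ← WittVector.frobeniusEquiv_apply, RingEquiv.symm_apply_apply]

omit [CharZero F] [IsAdicComplete (Ideal.span {(p : integerC F)}) (integerC F)] in
/-- **`φᵐ(σʲξ) = φ^{m−j}(ξ)` for `j ≤ m`.** [cite: FontaineAsterisque223III, Exp. III §5.1] -/
theorem frobenius_iterate_symm_iterate_xi {j m : ℕ} (hjm : j ≤ m) :
    (WittVector.frobenius : Ainf (p := p) F →+* Ainf (p := p) F)^[m]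
      (((WittVector.frobeniusEquiv p (PreTilt (integerC F) p)).symm : Ainf (p := p) F → Ainf (p := p) F)^[j] xi) =
      (WittVector.frobenius : Ainf (p := p) F →+* Ainf (p := p) F)^[m - j] xi := by
  obtain ⟨i, rfl⟩ := Nat.exists_eq_add_of_le hjm
  rw [Nat.add_sub_cancel_left, add_comm, Function.iterate_add_apply, frobenius_iterate_symm_iterate]

/-- **`θ(φᵐ(σʲξ)) ≠ 0` for `j < m`.** [cite: FontaineAsterisque223III, Exp. III §5.1] -/
theorem fontaineTheta_frobenius_iterate_symm_iterate_xi_ne_zero {j m : ℕ} (hjm : j < m) :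
    fontaineTheta (integerC F) p ((WittVector.frobenius : Ainf (p := p) F →+* Ainf (p := p) F)^[m]
      (((WittVector.frobeniusEquiv p (PreTilt (integerC F) p)).symm : Ainf (p := p) F → Ainf (p := p) F)^[j] xi)) ≠ 0 := by
  rw [frobenius_iterate_symm_iterate_xi hjm.le]
  exact fontaineTheta_frobenius_iterate_xi_ne_zero (by omega)

/-- **`ker(θ ∘ φʲ) = σʲ(ξ)·𝔸_inf`**: if `θ(φʲ b) = 0` then `σʲ(ξ) ∣ b` (`ker θ = (ξ)` and `σ = φ⁻¹` is a ring automorphism).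
[cite: FontaineAsterisque223III, Exp. II Prop. 1.2.3] -/
theorem dvd_of_fontaineTheta_frobenius_iterate_eq_zero {j : ℕ} {b : Ainf (p := p) F}
    (hb : fontaineTheta (integerC F) p ((WittVector.frobenius : Ainf (p := p) F →+* Ainf (p := p) F)^[j] b) = 0) :
    ((WittVector.frobeniusEquiv p (PreTilt (integerC F) p)).symm : Ainf (p := p) F → Ainf (p := p) F)^[j] xi ∣ b := by
  obtain ⟨c, hc⟩ := xi_dvd_of_fontaineTheta_eq_zero hb
  refine ⟨(((WittVector.frobeniusEquiv p (PreTilt (integerC F) p)).symm : Ainf (p := p) F → Ainf (p := p) F)^[j]) c, ?_⟩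
  calc b = (((WittVector.frobeniusEquiv p (PreTilt (integerC F) p)).symm : Ainf (p := p) F → Ainf (p := p) F)^[j])
        ((WittVector.frobenius : Ainf (p := p) F →+* Ainf (p := p) F)^[j] b) := (symm_iterate_frobenius_iterate j b).symm
    _ = (((WittVector.frobeniusEquiv p (PreTilt (integerC F) p)).symm : Ainf (p := p) F → Ainf (p := p) F)^[j]) (xi * c) := by rw [hc]
    _ = _ := iterate_map_mul _ j xi c

/-! ### Step 1 of Fontaine's lemma: `θ(φᵏa) = 0` for `k ≤ n` forces `∏_{j≤n} σʲ(ξ) ∣ a` -/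

/-- ★ **If `θ(φᵏ a) = 0` for all `k ≤ n` then `a = (∏_{j ≤ n} σʲξ)·b`** for some `b ∈ 𝔸_inf` (induction on `n`: applying `θ∘φⁿ⁺¹` to
`a = (∏_{j≤n} σʲξ)·b` leaves `θ(φⁿ⁺¹ b) = 0` because `θ(φⁿ⁺¹(σʲξ)) = θ(φ^{n+1−j}ξ) ≠ 0` and `𝒪_{ℂ_F}` is a domain).
[cite: FontaineAsterisque223III, Exp. III §5.1] -/
theorem exists_eq_prod_mul_of_forall_fontaineTheta_frobenius_iterate_eq_zero (n : ℕ) :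
    ∀ {a : Ainf (p := p) F}, (∀ k ≤ n, fontaineTheta (integerC F) p ((WittVector.frobenius : Ainf (p := p) F →+* Ainf (p := p) F)^[k] a) = 0) →
      ∃ b : Ainf (p := p) F, a = (∏ j ∈ range (n + 1),
        ((((WittVector.frobeniusEquiv p (PreTilt (integerC F) p)).symm : Ainf (p := p) F → Ainf (p := p) F)^[j]) xi)) * b := by
  induction n with
  | zero =>
    intro a ha
    obtain ⟨b, hb⟩ := dvd_of_fontaineTheta_frobenius_iterate_eq_zero (j := 0) (ha 0 le_rfl)
    exact ⟨b, by rw [zero_add, prod_range_one]; exact hb⟩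
  | succ n ih =>
    intro a ha
    obtain ⟨b, hb⟩ := ih (fun k hk => ha k (hk.trans (Nat.le_succ n)))
    -- apply `θ ∘ φⁿ⁺¹`
    have h1 := ha (n + 1) le_rfl
    rw [hb, iterate_map_mul, map_mul] at h1
    have hP : fontaineTheta (integerC F) p ((WittVector.frobenius : Ainf (p := p) F →+* Ainf (p := p) F)^[n + 1]
        (∏ j ∈ range (n + 1), ((((WittVector.frobeniusEquiv p (PreTilt (integerC F) p)).symm :
          Ainf (p := p) F → Ainf (p := p) F)^[j]) xi))) ≠ 0 := by
      rw [← RingHom.coe_pow, map_prod, map_prod]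
      refine prod_ne_zero_iff.2 fun j hj => ?_
      rw [RingHom.coe_pow]
      exact fontaineTheta_frobenius_iterate_symm_iterate_xi_ne_zero (mem_range.1 hj)
    have h2 : fontaineTheta (integerC F) p ((WittVector.frobenius : Ainf (p := p) F →+* Ainf (p := p) F)^[n + 1] b) = 0 :=
      (mul_eq_zero.1 h1).resolve_left hP
    obtain ⟨b', hb'⟩ := dvd_of_fontaineTheta_frobenius_iterate_eq_zero h2
    exact ⟨b', by rw [prod_range_succ, mul_assoc, ← hb', ← hb]⟩

/-! ### `u = [ε] − 1`: `θ(φᵏu) = 0` for all `k`, and the telescoping `u = (∏_{j≤n} σʲω)·σⁿ⁺¹(u)` -/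

/-- **`θ(φᵏ u) = 0` for every `k ≥ 0`** (`φᵏ u = [ε^{pᵏ}] − 1` and `θ[ε^a] = 1`): `u` lies in Fontaine's ideal `I^{[1]}𝔸_inf`.
[cite: FontaineAsterisque223III, Exp. III §5.1] -/
theorem fontaineTheta_frobenius_iterate_uAinf (k : ℕ) :
    fontaineTheta (integerC F) p ((WittVector.frobenius : Ainf (p := p) F →+* Ainf (p := p) F)^[k] uAinf) = 0 := by
  have h : (WittVector.frobenius : Ainf (p := p) F →+* Ainf (p := p) F)^[k] uAinf = teichmuller p (eps ^ p ^ k) - 1 := by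
    induction k with
    | zero => rw [Function.iterate_zero, id, pow_zero, pow_one, uAinf_def]
    | succ k ih => rw [Function.iterate_succ_apply', ih, map_sub, map_one, frobenius_teichmuller, ← map_pow, ← pow_mul, ← pow_succ]
  rw [h, map_sub, map_one, fontaineTheta_teichmuller, map_pow, untilt_eps, one_pow, sub_self]

omit [IsAdicComplete (Ideal.span {(p : integerC F)}) (integerC F)] in
/-- `σ(u) = [ε^{1/p}] − 1`. [cite: FontaineOuyang2022, Prop. 5.1.6] -/
theorem frobeniusEquiv_symm_uAinf :
    (WittVector.frobeniusEquiv p (PreTilt (integerC F) p)).symm (uAinf : Ainf (p := p) F) = teichmuller p epsRoot - 1 := by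
  rw [uAinf_def, map_sub, map_one, WittVector.frobeniusEquiv_symm_apply, map_teichmuller]
  rfl

omit [IsAdicComplete (Ideal.span {(p : integerC F)}) (integerC F)] in
/-- **`u = σ(u)·ω`** (`FontaineOmega.uAinf_eq_mul_omega` rewritten with `σ = φ⁻¹`). [cite: FontaineOuyang2022, Prop. 5.1.6] -/
theorem uAinf_eq_frobeniusEquiv_symm_mul_omega :
    (uAinf : Ainf (p := p) F) = (WittVector.frobeniusEquiv p (PreTilt (integerC F) p)).symm uAinf * omega := by
  rw [frobeniusEquiv_symm_uAinf]; exact uAinf_eq_mul_omega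

omit [IsAdicComplete (Ideal.span {(p : integerC F)}) (integerC F)] in
/-- **Telescoping: `u = (∏_{j ≤ n} σʲω) · σⁿ⁺¹(u)`** (`σʲu = σʲ⁺¹u · σʲω`). [cite: FontaineAsterisque223III, Exp. III §5.1] -/
theorem uAinf_eq_prod_mul_symm_iterate (n : ℕ) :
    (uAinf : Ainf (p := p) F) = (∏ j ∈ range (n + 1),
        (((WittVector.frobeniusEquiv p (PreTilt (integerC F) p)).symm : Ainf (p := p) F → Ainf (p := p) F)^[j]) omega) *
      (((WittVector.frobeniusEquiv p (PreTilt (integerC F) p)).symm : Ainf (p := p) F → Ainf (p := p) F)^[n + 1]) uAinf := by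
  induction n with
  | zero =>
    rw [zero_add, prod_range_one, Function.iterate_zero, id, Function.iterate_one, mul_comm]
    exact uAinf_eq_frobeniusEquiv_symm_mul_omega
  | succ n ih =>
    have hstep : (((WittVector.frobeniusEquiv p (PreTilt (integerC F) p)).symm : Ainf (p := p) F → Ainf (p := p) F)^[n + 1]) uAinf =
        (((WittVector.frobeniusEquiv p (PreTilt (integerC F) p)).symm : Ainf (p := p) F → Ainf (p := p) F)^[n + 1 + 1]) uAinf *
          (((WittVector.frobeniusEquiv p (PreTilt (integerC F) p)).symm : Ainf (p := p) F → Ainf (p := p) F)^[n + 1]) omega := by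
      conv_lhs => rw [uAinf_eq_frobeniusEquiv_symm_mul_omega]
      rw [iterate_map_mul, ← Function.iterate_succ_apply]
    conv_lhs => rw [ih, hstep]
    rw [prod_range_succ _ (n + 1)]
    ring

end Literature.NumberTheory.PAdicHodge

end
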